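import Summits.HodgeConjecture.HodgeConjecture.Theorems.MarkmanPartnerTransportK3Sq2TypeHodgeOfHKSpread
import Literature.AlgebraicGeometry.Motives.ConstantFamilyFibre
import Literature.AlgebraicGeometry.Motives.VarietiesProjectiveSpaceProofs
import Literature.AlgebraicGeometry.HodgeTheory.ZariskiClosedNowhereDense
import Literature.AlgebraicGeometry.HodgeTheory.GysinFormalismPushforward
import Literature.AlgebraicGeometry.HodgeTheory.CorrespondenceCupProductIdentities
import Literature.AlgebraicGeometry.HodgeTheory.AlgebraicClassesPullback

/-!
# Route MarkmanPartnerTransport · crux `LowPicardRealMultiplication` (stmt-HodgeConjecture-19653) — the input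
# structure `HKSpreadFamily` is INHABITED exactly when the endomorphism is cycle-induced (non-vacuity; lossless)

`X`-side twin of `…PicardThreeK3SquaresRMSpreadOfCycleInduced` (K3 squares): for a smooth projective fourfold
`X` and an endomorphism `t` of `H²(X(ℂ); ℂ)`,

* `nonempty_hkSpreadFamily_of_exists_algebraicClass` — if `t = [Z]_*` (`corrAction`, complex orientations) for an
  algebraic `Z ∈ A⁴(X × X)`, the CONSTANT family `pr₂ : (X ⊗ X) ⊗ ℙ¹ ⟶ ℙ¹` (`isSmoothProjectiveFamily_snd`,
  `sliceFiberIso`) with the global section of `pr₁^* Z` and `𝟙_{ℙ¹}` as dominant classifying morphism is an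
  `HKSpreadFamily X hX t`;
* `nonempty_hkSpreadFamily_iff_exists_algebraicClass` — **`Nonempty (HKSpreadFamily X hX t) ↔ t` is induced by an
  algebraic class on `X × X`** (⇒ is `HKSpreadFamily.exists_algebraicClass`, the spread).

So the `X`-side structure is jointly satisfiable and exactly as strong as cycle-inducedness of `t` (the
hypothesis of the `X`-side F4 `hodgeConjectureFor_of_cycleInducedGenerator`). Unconditional; no definition, no
sorry. Prover seat hodge-nonav-19652-p1 (gen 7), `--supports stmt-HodgeConjecture-19653`. Nothing here proves HC.

References: Hartshorne, *Algebraic Geometry*, II.3, III Prop. 10.1 (b); Voisin, *Hodge Theory II* (2003), §7.3.2.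
-/

set_option linter.dupNamespace false

noncomputable section

namespace Summit.HodgeConjecture.HodgeConjecture.Theorems.MarkmanPartnerTransport

open CategoryTheory MonoidalCategory CartesianMonoidalCategory AlgebraicGeometry
open Literature.AlgebraicGeometry Literature.AlgebraicGeometry.Motives Literature.AlgebraicGeometry.HodgeTheory
open Literature.AlgebraicTopology.SingularHomology

variable {X : SchemeOver ℂ}

/-- **A cycle-induced endomorphism of `H²` of a smooth projective fourfold has a (constant) spread family.** If
`t = [Z]_*` for an algebraic `Z ∈ A⁴(X × X)`, then `HKSpreadFamily X hX t` is inhabited by the constant family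
`pr₂ : (X ⊗ X) ⊗ ℙ¹ ⟶ ℙ¹`, the flat section `b ↦ (b, (pr₁^* Z)|_b)` (`globalSection`), the slice isomorphism
`X ⊗ X ≅ ((X ⊗ X) ⊗ ℙ¹)_b` (`sliceFiberIso`: composed with the fibre inclusion and `pr₁` it is the identity, so
the value pulls back to `Z`), and `𝟙_{ℙ¹}` (every fibre value is `Z` pulled back along the inverse slice
isomorphism, hence algebraic). [cite: Hartshorne1977, II.3 (p. 89) and III Prop. 10.1 (b)]
[cite: VoisinHodgeII2003, §7.3.2] -/
theorem nonempty_hkSpreadFamily_of_exists_algebraicClass (hX : IsSmoothProjective 4 X)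
    (t : complexBetti X 2 →ₗ[ℂ] complexBetti X 2)
    (hZt : ∃ Z ∈ algebraicClasses (X ⊗ X) 4, ∀ y : complexBetti X 2,
      t y = corrAction complexOrientationFamily hX hX (rfl : 2 + 2 * 4 = 2 + 2 * 4) Z y) :
    Nonempty (HKSpreadFamily X hX t) := by
  obtain ⟨Z, hZ, ht⟩ := hZt
  set P : SchemeOver ℂ := projectiveSpace 1 ℂ with hP_def
  have hP : IsSmoothProjective 1 P := isSmoothProjective_projectiveSpace_holds ℂ 1
  have hXX : IsSmoothProjective (4 + 4) (X ⊗ X) := IsSmoothProjective.tensor_holds hX hX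
  have hTot : IsSmoothProjective ((4 + 4) + 1) ((X ⊗ X) ⊗ P) := IsSmoothProjective.tensor_holds hXX hP
  haveI := hP.smoothOfRelativeDimension
  have hPsm : AlgebraicGeometry.Smooth P.hom := SmoothOfRelativeDimension.smooth 1 P.hom
  have hPirr : IrreducibleSpace P.left := irreducibleSpace_of_isSmoothProjective' hP
  have hPqp : IsQuasiProjectiveOver P := IsQuasiProjectiveOver.of_isProjectiveOver hP.isProjectiveOver
  haveI : IsSeparated P.hom := hPqp.isVarietyPair_ofScheme.isSeparated
  haveI : LocallyOfFiniteType P.hom := locallyOfFiniteType_of_isQuasiProjectiveOver hPqp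
  obtain ⟨b₁⟩ := nonempty_complexPoints hP
  let g : (X ⊗ X) ⊗ P ⟶ P := snd (X ⊗ X) P
  let W : complexBetti ((X ⊗ X) ⊗ P) (2 * 4) := complexBetti.map (fst (X ⊗ X) P) (2 * 4) Z
  have hval : ∀ b : ComplexPoints P,
      complexBetti.map (fiberι g b) (2 * 4) W =
        complexBetti.map (sliceFiberIso (X ⊗ X) b).inv (2 * 4) Z := by
    intro b
    have hcomp : fiberι g b ≫ fst (X ⊗ X) P = (sliceFiberIso (X ⊗ X) b).inv := by
      rw [← cancel_epi (sliceFiberIso (X ⊗ X) b).hom, Iso.hom_inv_id]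
      exact sliceFiberIso_hom_fiberι_fst (X ⊗ X) b
    change complexBetti.map (fiberι g b) (2 * 4) (complexBetti.map (fst (X ⊗ X) P) (2 * 4) Z) = _
    rw [← complexBetti.map_comp_apply', hcomp]
  have halg : ∀ b : ComplexPoints P,
      complexBetti.map (fiberι g b) (2 * 4) W ∈ algebraicClasses (fiberOver g b) 4 := by
    intro b
    rw [hval b]
    exact map_mem_algebraicClasses_of_isIso (sliceFiberIso (X ⊗ X) b).inv hZ
  have hback : complexBetti.map (sliceFiberIso (X ⊗ X) b₁).hom (2 * 4)
      (complexBetti.map (fiberι g b₁) (2 * 4) W) = Z := by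
    rw [hval b₁, ← complexBetti.map_comp_apply', Iso.hom_inv_id, complexBetti.map_id, ModuleCat.id_apply]
  have hcls : ∀ b : ComplexPoints P,
      (globalSection g (2 * 4) W b).clsAt (t := b) rfl = complexBetti.map (fiberι g b) (2 * 4) W :=
    fun b => rfl
  refine ⟨{
    base := P
    total := (X ⊗ X) ⊗ P
    family := g
    relDim := 4 + 4
    isSmoothProjectiveFamily := isSmoothProjectiveFamily_snd hXX P
    total_quasiProjective := IsQuasiProjectiveOver.of_isProjectiveOver hTot.isProjectiveOver
    base_quasiProjective := hPqp
    base_smooth := hPsm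
    base_irreducible := hPirr
    flatSection := globalSection g (2 * 4) W
    flatSection_continuous := continuous_globalSection g (2 * 4) W
    flatSection_pt := fun b => rfl
    pt₁ := b₁
    fibreIso := sliceFiberIso (X ⊗ X) b₁
    induces := ?_
    param := P
    classify := 𝟙 P
    param_irreducible := hPirr
    param_isSeparated := inferInstance
    param_locallyOfFiniteType := inferInstance
    param_nonempty := ⟨b₁⟩
    classify_denseRange := fun x => subset_closure ⟨x, rfl⟩
    algebraic_over_param := fun v => ?_ }⟩
  · intro y
    rw [hcls b₁, hback]
    exact ht y
  · rw [hcls (AlgPoints.map (𝟙 P) v)]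
    exact halg _

/-- **`HKSpreadFamily X hX t` is inhabited iff `t` is induced by an algebraic class on `X × X`** — the `X`-side
spread input is LOSSLESS (⇒ `HKSpreadFamily.exists_algebraicClass`, the spread; ⇐ the constant family). Its
right-hand side is the cycle-inducedness hypothesis of the `X`-side F4 `hodgeConjectureFor_of_cycleInducedGenerator`.
[cite: VoisinHodgeII2003, §7.3.2] [cite: Hartshorne1977, II.3 (p. 89)] -/
theorem nonempty_hkSpreadFamily_iff_exists_algebraicClass (hX : IsSmoothProjective 4 X)
    (t : complexBetti X 2 →ₗ[ℂ] complexBetti X 2) :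
    Nonempty (HKSpreadFamily X hX t) ↔
      ∃ Z ∈ algebraicClasses (X ⊗ X) 4, ∀ y : complexBetti X 2,
        t y = corrAction complexOrientationFamily hX hX (rfl : 2 + 2 * 4 = 2 + 2 * 4) Z y :=
  ⟨fun ⟨F⟩ => F.exists_algebraicClass, nonempty_hkSpreadFamily_of_exists_algebraicClass hX t⟩

end Summit.HodgeConjecture.HodgeConjecture.Theorems.MarkmanPartnerTransport
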